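import Summits.AtomisticToContinuum.HydrodynamicLimit.Theses.BoxDissipativeWeakStrong
import Summits.AtomisticToContinuum.HydrodynamicLimit.Theses.InvariantGibbsBookkeeping

/-!
# Route BoxDissipativeWeakStrong — `HsEntropyConvex` (item stmt-AtomisticToContinuum-9906)

Thermodynamic stability of the dilute hard-sphere gas in CONSERVED variables: given the low-density
equation-of-state fact (the excess free energy `f_ex` agrees on `[0, η₀)` with a function `F`
analytic on `(-η₀, η₀)`), there is `η₁ > 0` such that for every `σ > 0` the negative entropy
density
  `U = (ρ, m, E) ↦ -ρ (3/2 log θ(U) - log ρ - f_ex(ρσ³))`,  `θ(U) = 2/3 (E/ρ - ‖m‖²/(2ρ²))`,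
is strictly convex on the convex set `{ρ > 0, ρσ³ < η₁, ‖m‖² < 2ρE}`.

Proof (the classical perspective argument, Dafermos / Harten–Lax): in the specific variables
`(τ, v, ε) = (1/ρ, m/ρ, E/ρ)` the negative specific entropy splits as
`g(τ, v, ε) = [-log τ + F(σ³/τ)] + [-3/2 log(2/3 (ε - ‖v‖²/2))]`;
the configurational part is strictly convex in `τ` for `σ³/τ < η₁` because its derivative is
`-σ⁻³ h(σ³/τ)` with `h(η) = η + η² F'(η) = η Z(η)` strictly increasing near `0`
(`h'(0) = 1`, continuity of `F', F''`); the thermal part is strictly convex in `(v, ε)` because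
`log` is strictly concave and increasing and `(v, ε) ↦ ε - ‖v‖²/2` is concave, strictly so in `v`
(inner-product norm). Finally `f(ρ, m, E) = ρ g(1/ρ, m/ρ, E/ρ)` is the perspective of `g`, and the
perspective of a strictly convex function is strictly convex once the ray direction is pinned
(`τ = 1/ρ` determines `ρ`).

References: Dafermos1979 (relative entropy / convex entropies), BrezinaFeireisl2018 (hypothesis of
thermodynamic stability (WS1)), Ruelle1969 (analyticity of the hard-sphere free energy at low
density — entering only through the hypothesis).
-/

namespace Summit.AtomisticToContinuum.HydrodynamicLimit.Theorems

open Set Filter Topology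

section GeneralLemmas

variable {W : Type*} [AddCommGroup W] [Module ℝ W]

/-- **Perspective of a strictly convex function.** If `g` is strictly convex on `D ⊆ ℝ × W`, then
`(ρ, w) ↦ ρ · g(ρ⁻¹, ρ⁻¹ • w)` is strictly convex on `{ρ > 0, (ρ⁻¹, ρ⁻¹ • w) ∈ D}`; strictness
survives because the first specific coordinate `ρ⁻¹` pins the ray. [folklore] -/
theorem strictConvexOn_perspective {D : Set (ℝ × W)} {g : ℝ × W → ℝ}
    (hg : StrictConvexOn ℝ D g) :
    StrictConvexOn ℝ {p : ℝ × W | 0 < p.1 ∧ (p.1⁻¹, p.1⁻¹ • p.2) ∈ D}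
      (fun p => p.1 * g (p.1⁻¹, p.1⁻¹ • p.2)) := by
  -- barycentric identity for the specific variables
  have key : ∀ (x y : ℝ × W) (a b : ℝ), 0 < x.1 → 0 < y.1 → 0 < a → 0 < b → a + b = 1 →
      ((a • x + b • y).1⁻¹, (a • x + b • y).1⁻¹ • (a • x + b • y).2) =
        (a * x.1 / (a * x.1 + b * y.1)) • (x.1⁻¹, x.1⁻¹ • x.2) +
          (b * y.1 / (a * x.1 + b * y.1)) • (y.1⁻¹, y.1⁻¹ • y.2) := by
    intro x y a b hx hy ha hb hab
    have hρ : 0 < a * x.1 + b * y.1 := by positivity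
    have hρ' : a * x.1 + b * y.1 ≠ 0 := hρ.ne'
    have hx' : x.1 ≠ 0 := hx.ne'
    have hy' : y.1 ≠ 0 := hy.ne'
    rw [Prod.smul_mk, Prod.smul_mk, Prod.mk_add_mk, Prod.mk.injEq]
    refine ⟨?_, ?_⟩
    · simp only [Prod.fst_add, Prod.smul_fst, smul_eq_mul]
      rw [div_mul_eq_mul_div, mul_inv_cancel_right₀ hx', div_mul_eq_mul_div,
        mul_inv_cancel_right₀ hy', ← add_div, hab, one_div]
    · simp only [Prod.snd_add, Prod.smul_snd, smul_eq_mul, smul_add, smul_smul]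
      congr 1
      · congr 1
        field_simp
      · congr 1
        field_simp
  refine ⟨?_, ?_⟩
  · rw [convex_iff_forall_pos]
    rintro x ⟨hx, hxD⟩ y ⟨hy, hyD⟩ a b ha hb hab
    have hρ : 0 < a * x.1 + b * y.1 := by positivity
    refine ⟨?_, ?_⟩
    · simpa only [Prod.fst_add, Prod.smul_fst, smul_eq_mul] using hρ
    · rw [key x y a b hx hy ha hb hab]
      exact hg.1 hxD hyD (div_pos (mul_pos ha hx) hρ).le (div_pos (mul_pos hb hy) hρ).le
        (by field_simp)
  · rintro x ⟨hx, hxD⟩ y ⟨hy, hyD⟩ hxy a b ha hb hab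
    have hρ : 0 < a * x.1 + b * y.1 := by positivity
    have hne : (x.1⁻¹, x.1⁻¹ • x.2) ≠ (y.1⁻¹, y.1⁻¹ • y.2) := by
      intro h
      apply hxy
      rw [Prod.mk.injEq] at h
      have h1 : x.1 = y.1 := inv_injective h.1
      have h2 : x.2 = y.2 := by
        have h2' := congrArg (fun w => x.1 • w) h.2
        rwa [smul_inv_smul₀ hx.ne', ← h1, smul_inv_smul₀ hx.ne'] at h2'
      exact Prod.ext h1 h2
    have hlt := hg.2 hxD hyD hne (div_pos (mul_pos ha hx) hρ) (div_pos (mul_pos hb hy) hρ)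
      (by field_simp)
    have hfst : (a • x + b • y).1 = a * x.1 + b * y.1 := by
      simp only [Prod.fst_add, Prod.smul_fst, smul_eq_mul]
    beta_reduce
    rw [key x y a b hx hy ha hb hab, hfst]
    have h2 := mul_lt_mul_of_pos_left hlt hρ
    simp only [smul_eq_mul] at h2 ⊢
    refine h2.trans_eq ?_
    field_simp

/-- The sum of two strictly convex functions of SEPARATE variables is strictly convex on the
product set. [folklore] -/
theorem strictConvexOn_prod_add {E₁ E₂ : Type*} [AddCommGroup E₁] [Module ℝ E₁]
    [AddCommGroup E₂] [Module ℝ E₂] {A : Set E₁} {B : Set E₂} {g₁ : E₁ → ℝ} {g₂ : E₂ → ℝ}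
    (h₁ : StrictConvexOn ℝ A g₁) (h₂ : StrictConvexOn ℝ B g₂) :
    StrictConvexOn ℝ (A ×ˢ B) (fun p => g₁ p.1 + g₂ p.2) := by
  refine ⟨h₁.1.prod h₂.1, ?_⟩
  intro x hx y hy hxy a b ha hb hab
  simp only [Prod.fst_add, Prod.snd_add, Prod.smul_fst, Prod.smul_snd, smul_eq_mul]
  by_cases h : x.1 = y.1
  · have h' : x.2 ≠ y.2 := fun h'' => hxy (Prod.ext h h'')
    have i1 := h₁.convexOn.2 hx.1 hy.1 ha.le hb.le hab
    have i2 := h₂.2 hx.2 hy.2 h' ha hb hab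
    simp only [smul_eq_mul] at i1 i2
    linarith
  · have i1 := h₁.2 hx.1 hy.1 h ha hb hab
    have i2 := h₂.convexOn.2 hx.2 hy.2 ha.le hb.le hab
    simp only [smul_eq_mul] at i1 i2
    linarith

end GeneralLemmas

open Literature.MathematicalPhysics.KineticTheory (V3)

/-- Strict convexity of the squared inner-product norm along segments:
`‖a v + b w‖² = a‖v‖² + b‖w‖² - ab‖v - w‖²` for `a + b = 1`. [folklore] -/
theorem norm_sq_combo_eq (v w : V3) {a b : ℝ} (hab : a + b = 1) :
    ‖a • v + b • w‖ ^ 2 = a * ‖v‖ ^ 2 + b * ‖w‖ ^ 2 - a * b * ‖v - w‖ ^ 2 := by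
  rw [norm_add_sq_real, norm_sub_sq_real, norm_smul, norm_smul, real_inner_smul_left,
    real_inner_smul_right, Real.norm_eq_abs, Real.norm_eq_abs, mul_pow, mul_pow, sq_abs, sq_abs]
  linear_combination (a * ‖v‖ ^ 2 + b * ‖w‖ ^ 2) * hab

/-- **Thermal part.** `(v, ε) ↦ -3/2 log(2/3 (ε - ‖v‖²/2))` (minus the ideal-gas specific entropy
as a function of velocity and specific total energy) is strictly convex on `{‖v‖² < 2ε}`:
`log` is strictly concave and increasing, `ε - ‖v‖²/2` is concave and strictly concave in `v`.
[folklore] -/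
theorem strictConvexOn_thermal :
    StrictConvexOn ℝ {w : V3 × ℝ | ‖w.1‖ ^ 2 < 2 * w.2}
      (fun w => -(3 / 2 * Real.log (2 / 3 * (w.2 - ‖w.1‖ ^ 2 / 2)))) := by
  refine ⟨?_, ?_⟩
  · rw [convex_iff_forall_pos]
    intro x hx y hy a b ha hb hab
    simp only [mem_setOf_eq, Prod.fst_add, Prod.snd_add, Prod.smul_fst, Prod.smul_snd,
      smul_eq_mul] at hx hy ⊢
    rw [norm_sq_combo_eq _ _ hab]
    nlinarith [mul_pos ha (sub_pos.2 hx), mul_pos hb (sub_pos.2 hy),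
      mul_nonneg (mul_nonneg ha.le hb.le) (sq_nonneg ‖x.1 - y.1‖)]
  · intro x hx y hy hxy a b ha hb hab
    simp only [mem_setOf_eq] at hx hy
    simp only [Prod.fst_add, Prod.snd_add, Prod.smul_fst, Prod.smul_snd, smul_eq_mul]
    have hsx : 0 < x.2 - ‖x.1‖ ^ 2 / 2 := by linarith
    have hsy : 0 < y.2 - ‖y.1‖ ^ 2 / 2 := by linarith
    have hs : a * x.2 + b * y.2 - ‖a • x.1 + b • y.1‖ ^ 2 / 2 =
        a * (x.2 - ‖x.1‖ ^ 2 / 2) + b * (y.2 - ‖y.1‖ ^ 2 / 2) + a * b / 2 * ‖x.1 - y.1‖ ^ 2 := by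
      rw [norm_sq_combo_eq _ _ hab]; ring
    rw [hs]
    have hcomb : a * Real.log (2 / 3 * (x.2 - ‖x.1‖ ^ 2 / 2)) +
        b * Real.log (2 / 3 * (y.2 - ‖y.1‖ ^ 2 / 2)) ≤
        Real.log (a * (2 / 3 * (x.2 - ‖x.1‖ ^ 2 / 2)) + b * (2 / 3 * (y.2 - ‖y.1‖ ^ 2 / 2))) := by
      have := strictConcaveOn_log_Ioi.concaveOn.2 (mem_Ioi.2 (by positivity :
        (0:ℝ) < 2 / 3 * (x.2 - ‖x.1‖ ^ 2 / 2))) (mem_Ioi.2 (by positivity :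
        (0:ℝ) < 2 / 3 * (y.2 - ‖y.1‖ ^ 2 / 2))) ha.le hb.le hab
      simpa only [smul_eq_mul] using this
    have hmono : Real.log (a * (2 / 3 * (x.2 - ‖x.1‖ ^ 2 / 2)) +
        b * (2 / 3 * (y.2 - ‖y.1‖ ^ 2 / 2))) ≤
        Real.log (2 / 3 * (a * (x.2 - ‖x.1‖ ^ 2 / 2) + b * (y.2 - ‖y.1‖ ^ 2 / 2) +
          a * b / 2 * ‖x.1 - y.1‖ ^ 2)) := by
      apply Real.log_le_log (by positivity)
      nlinarith [mul_nonneg (mul_nonneg ha.le hb.le) (sq_nonneg ‖x.1 - y.1‖)]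
    by_cases hv : x.1 = y.1
    · have hne : 2 / 3 * (x.2 - ‖x.1‖ ^ 2 / 2) ≠ 2 / 3 * (y.2 - ‖y.1‖ ^ 2 / 2) := by
        intro h
        apply hxy
        refine Prod.ext hv ?_
        rw [hv] at h
        linarith
      have hstrict := strictConcaveOn_log_Ioi.2 (mem_Ioi.2 (by positivity :
        (0:ℝ) < 2 / 3 * (x.2 - ‖x.1‖ ^ 2 / 2))) (mem_Ioi.2 (by positivity :
        (0:ℝ) < 2 / 3 * (y.2 - ‖y.1‖ ^ 2 / 2))) hne ha hb hab
      simp only [smul_eq_mul] at hstrict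
      linarith
    · have hpos : 0 < ‖x.1 - y.1‖ := norm_pos_iff.2 (sub_ne_zero.2 hv)
      have hstrict : Real.log (a * (2 / 3 * (x.2 - ‖x.1‖ ^ 2 / 2)) +
          b * (2 / 3 * (y.2 - ‖y.1‖ ^ 2 / 2))) <
          Real.log (2 / 3 * (a * (x.2 - ‖x.1‖ ^ 2 / 2) + b * (y.2 - ‖y.1‖ ^ 2 / 2) +
            a * b / 2 * ‖x.1 - y.1‖ ^ 2)) := by
        apply Real.log_lt_log (by positivity)
        nlinarith [mul_pos (mul_pos ha hb) (pow_pos hpos 2)]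
      linarith

/-- **Configurational part.** If `F` is analytic on `(-η₀, η₀)`, there is `η₁ ∈ (0, η₀]` such that
for every `σ > 0` the function `τ ↦ -log τ + F(σ³/τ)` (minus the configurational specific entropy
of the hard-sphere gas as a function of the specific volume `τ`) is strictly convex on
`{τ > σ³/η₁}`: its derivative is `-σ⁻³ h(σ³/τ)` with `h(η) = η + η² F'(η)` (`= η Z(η)`,
`Z` the compressibility factor), and `h' = 1 + 2ηF' + η²F''` is positive near `0`. [folklore] -/
theorem exists_strictConvexOn_config {η₀ : ℝ} (hη₀ : 0 < η₀) {F : ℝ → ℝ}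
    (hF : AnalyticOnNhd ℝ F (Ioo (-η₀) η₀)) :
    ∃ η₁ : ℝ, 0 < η₁ ∧ η₁ ≤ η₀ ∧ ∀ σ : ℝ, 0 < σ →
      StrictConvexOn ℝ (Ioi (σ ^ 3 / η₁)) (fun τ => -Real.log τ + F (τ⁻¹ * σ ^ 3)) := by
  have hF' : AnalyticOnNhd ℝ (deriv F) (Ioo (-η₀) η₀) := hF.deriv
  have hF'' : AnalyticOnNhd ℝ (deriv (deriv F)) (Ioo (-η₀) η₀) := hF'.deriv
  have h0mem : (0:ℝ) ∈ Ioo (-η₀) η₀ := ⟨by linarith, hη₀⟩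
  -- the derivative of `h(η) = η + η·η·F'(η)`
  set φ : ℝ → ℝ := fun η => 1 + ((1 * η + η * 1) * deriv F η + η * η * deriv (deriv F) η) with hφ
  have hφcont : ContinuousAt φ 0 := by
    have h1 : ContinuousAt (deriv F) 0 := (hF' 0 h0mem).continuousAt
    have h2 : ContinuousAt (deriv (deriv F)) 0 := (hF'' 0 h0mem).continuousAt
    simp only [hφ]
    fun_prop
  have hφ0 : (0:ℝ) < φ 0 := by simp [hφ]
  obtain ⟨δ, hδ, hδφ⟩ : ∃ δ > 0, ∀ η : ℝ, |η| < δ → 0 < φ η := by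
    have hev : ∀ᶠ η in 𝓝 (0:ℝ), 0 < φ η := hφcont.eventually (lt_mem_nhds hφ0)
    obtain ⟨δ, hδ, h⟩ := Metric.eventually_nhds_iff.1 hev
    exact ⟨δ, hδ, fun η hη => h (by simpa [Real.dist_eq] using hη)⟩
  -- h is strictly increasing on (0, min η₀ δ)
  set η₁ := min η₀ δ with hη₁def
  have hη₁ : 0 < η₁ := lt_min hη₀ hδ
  have hη₁le : η₁ ≤ η₀ := min_le_left _ _
  have hη₁δ : η₁ ≤ δ := min_le_right _ _
  set h : ℝ → ℝ := fun η => η + η * η * deriv F η with hhdef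
  have hhd : ∀ η ∈ Ioo (-η₀) η₀, HasDerivAt h (φ η) η := by
    intro η hη
    have hd : HasDerivAt (deriv F) (deriv (deriv F) η) η :=
      ((hF' η hη).differentiableAt).hasDerivAt
    exact (hasDerivAt_id η).add (((hasDerivAt_id η).mul (hasDerivAt_id η)).mul hd)
  have hhmono : StrictMonoOn h (Ioo 0 η₁) := by
    apply strictMonoOn_of_deriv_pos (convex_Ioo 0 η₁)
    · intro η hη
      exact (hhd η ⟨by linarith [hη.1], lt_of_lt_of_le hη.2 hη₁le⟩).continuousAt.continuousWithinAt
    · intro η hη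
      rw [interior_Ioo] at hη
      rw [(hhd η ⟨by linarith [hη.1], lt_of_lt_of_le hη.2 hη₁le⟩).deriv]
      apply hδφ
      rw [abs_of_pos hη.1]
      exact lt_of_lt_of_le hη.2 hη₁δ
  refine ⟨η₁, hη₁, hη₁le, fun σ hσ => ?_⟩
  have hσ3 : 0 < σ ^ 3 := by positivity
  have hc : 0 < σ ^ 3 / η₁ := div_pos hσ3 hη₁
  -- specific volume ↦ packing fraction
  have hηmem : ∀ τ ∈ Ioi (σ ^ 3 / η₁), τ⁻¹ * σ ^ 3 ∈ Ioo 0 η₁ := by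
    intro τ hτ
    have hτpos : 0 < τ := hc.trans hτ
    refine ⟨by positivity, ?_⟩
    rw [inv_mul_eq_div, div_lt_iff₀ hτpos]
    have := (div_lt_iff₀ hη₁).1 (mem_Ioi.1 hτ)
    linarith
  -- derivative of the configurational part
  set g' : ℝ → ℝ := fun τ => -τ⁻¹ + deriv F (τ⁻¹ * σ ^ 3) * (-(τ ^ 2)⁻¹ * σ ^ 3) with hg'def
  have hgd : ∀ τ ∈ Ioi (σ ^ 3 / η₁),
      HasDerivAt (fun τ => -Real.log τ + F (τ⁻¹ * σ ^ 3)) (g' τ) τ := by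
    intro τ hτ
    have hτpos : 0 < τ := hc.trans hτ
    have hη := hηmem τ hτ
    have hFd : HasDerivAt F (deriv F (τ⁻¹ * σ ^ 3)) (τ⁻¹ * σ ^ 3) :=
      ((hF _ ⟨by linarith [hη.1], lt_of_lt_of_le hη.2 hη₁le⟩).differentiableAt).hasDerivAt
    have hinner : HasDerivAt (fun τ : ℝ => τ⁻¹ * σ ^ 3) (-(τ ^ 2)⁻¹ * σ ^ 3) τ :=
      (hasDerivAt_inv hτpos.ne').mul_const _
    exact ((Real.hasDerivAt_log hτpos.ne').neg).add (hFd.comp τ hinner)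
  have hg'eq : ∀ τ ∈ Ioi (σ ^ 3 / η₁), g' τ = -(σ ^ 3)⁻¹ * h (τ⁻¹ * σ ^ 3) := by
    intro τ hτ
    have hτpos : 0 < τ := hc.trans hτ
    simp only [hg'def, hhdef]
    field_simp
    ring
  apply StrictMonoOn.strictConvexOn_of_deriv (convex_Ioi _)
  · exact fun τ hτ => (hgd τ hτ).continuousAt.continuousWithinAt
  · rw [interior_Ioi]
    have hmono : StrictMonoOn g' (Ioi (σ ^ 3 / η₁)) := by
      intro τ₁ hτ₁ τ₂ hτ₂ hlt
      have hτ₁pos : 0 < τ₁ := hc.trans hτ₁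
      rw [hg'eq τ₁ hτ₁, hg'eq τ₂ hτ₂]
      have hηlt : τ₂⁻¹ * σ ^ 3 < τ₁⁻¹ * σ ^ 3 :=
        mul_lt_mul_of_pos_right ((inv_lt_inv₀ (hτ₁pos.trans hlt) hτ₁pos).2 hlt) hσ3
      have := hhmono (hηmem τ₂ hτ₂) (hηmem τ₁ hτ₁) hηlt
      have hneg : -(σ ^ 3)⁻¹ < 0 := neg_neg_of_pos (inv_pos.2 hσ3)
      exact mul_lt_mul_of_neg_left this hneg
    exact hmono.congr fun τ hτ => ((hgd τ hτ).deriv).symm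

open Literature.MathematicalPhysics.KineticTheory in
/-- Item stmt-AtomisticToContinuum-9906 of route BoxDissipativeWeakStrong (`HsEntropyConvex`,
BF18's thermodynamic-stability hypothesis (WS1) for the dilute hard-sphere gas): given the
low-density equation-of-state fact, there is `η₁ > 0` such that for every `σ > 0` the negative
entropy density `U = (ρ, m, E) ↦ -ρ (3/2 log(2/3 (E/ρ - ‖m‖²/(2ρ²))) - log ρ - f_ex(ρσ³))` is
strictly convex on `{ρ > 0, ρσ³ < η₁, ‖m‖² < 2ρE}`. Perspective of
`exists_strictConvexOn_config + strictConvexOn_thermal`. -/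
theorem hsEntropyConvex_proof :
    Summit.AtomisticToContinuum.HydrodynamicLimit.Theses.BoxDissipativeWeakStrong.HsEntropyConvex := by
  unfold Theses.BoxDissipativeWeakStrong.HsEntropyConvex
  rintro ⟨η₀, hη₀, F, hFan, hFeq, -, -, -⟩
  obtain ⟨η₁, hη₁, hη₁le, hconf⟩ := exists_strictConvexOn_config hη₀ hFan
  refine ⟨η₁, hη₁, fun σ hσ => ?_⟩
  have hσ3 : 0 < σ ^ 3 := by positivity
  have hg := strictConvexOn_perspective (strictConvexOn_prod_add (hconf σ hσ) strictConvexOn_thermal)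
  have hS : {U : ℝ × V3 × ℝ | 0 < U.1 ∧ U.1 * σ ^ 3 < η₁ ∧ ‖U.2.1‖ ^ 2 < 2 * U.1 * U.2.2} =
      {p : ℝ × V3 × ℝ | 0 < p.1 ∧ (p.1⁻¹, p.1⁻¹ • p.2) ∈
        Ioi (σ ^ 3 / η₁) ×ˢ {w : V3 × ℝ | ‖w.1‖ ^ 2 < 2 * w.2}} := by
    ext U
    simp only [mem_setOf_eq, mem_prod, mem_Ioi, Prod.smul_fst, Prod.smul_snd, smul_eq_mul]
    constructor
    · rintro ⟨h1, h2, h3⟩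
      refine ⟨h1, ?_, ?_⟩
      · rw [div_lt_iff₀ hη₁, inv_mul_eq_div, lt_div_iff₀ h1]
        linarith [mul_comm (U.1) (σ ^ 3)]
      · rw [norm_smul_of_nonneg (inv_pos.2 h1).le]
        have e1 : (U.1⁻¹ * ‖U.2.1‖) ^ 2 = ‖U.2.1‖ ^ 2 / U.1 ^ 2 := by field_simp
        have e2 : 2 * (U.1⁻¹ * U.2.2) = 2 * U.1 * U.2.2 / U.1 ^ 2 := by field_simp
        rw [e1, e2, div_lt_div_iff_of_pos_right (by positivity)]
        exact h3
    · rintro ⟨h1, h2, h3⟩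
      refine ⟨h1, ?_, ?_⟩
      · rw [div_lt_iff₀ hη₁, inv_mul_eq_div, lt_div_iff₀ h1] at h2
        linarith [mul_comm (U.1) (σ ^ 3)]
      · rw [norm_smul_of_nonneg (inv_pos.2 h1).le] at h3
        have e1 : (U.1⁻¹ * ‖U.2.1‖) ^ 2 = ‖U.2.1‖ ^ 2 / U.1 ^ 2 := by field_simp
        have e2 : 2 * (U.1⁻¹ * U.2.2) = 2 * U.1 * U.2.2 / U.1 ^ 2 := by field_simp
        rw [e1, e2, div_lt_div_iff_of_pos_right (by positivity)] at h3
        exact h3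
  rw [hS]
  refine hg.congr ?_
  rintro U ⟨hU, hUD⟩
  simp only [mem_prod, mem_Ioi, mem_setOf_eq] at hUD
  have hη : U.1 * σ ^ 3 ∈ Ico 0 η₀ := by
    refine ⟨by positivity, lt_of_lt_of_le ?_ hη₁le⟩
    have := hUD.1
    rw [div_lt_iff₀ hη₁, inv_mul_eq_div, lt_div_iff₀ hU] at this
    linarith [mul_comm (U.1) (σ ^ 3)]
  simp only [Prod.smul_fst, Prod.smul_snd, smul_eq_mul, inv_inv, Real.log_inv]
  rw [hFeq hη, norm_smul_of_nonneg (inv_pos.2 hU).le]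
  have harg : U.1⁻¹ * U.2.2 - (U.1⁻¹ * ‖U.2.1‖) ^ 2 / 2 =
      U.2.2 / U.1 - ‖U.2.1‖ ^ 2 / (2 * U.1 ^ 2) := by
    field_simp
  rw [harg]
  ring

/-- The same item as wanted (verbatim) by route InvariantGibbsBookkeeping: its decl
`InvariantGibbsBookkeeping.HsEntropyConvex` is definitionally the statement proved in
`hsEntropyConvex_proof`. -/
theorem hsEntropyConvex_proof' :
    Summit.AtomisticToContinuum.HydrodynamicLimit.Theses.InvariantGibbsBookkeeping.HsEntropyConvex :=
  hsEntropyConvex_proof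

end Summit.AtomisticToContinuum.HydrodynamicLimit.Theorems
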